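/-
Copyright: the b2b-balaban T⁴-continuum CRUX team, row NE7b leaf lineage `t4-ne7b-formalise-leaf-02` (gen 135). Project licence.
-/
import Summits.QuantumFields.BalabanUV.T4Continuum.Spine.NE7b.AdmissibleFloorSqLetter
import Summits.QuantumFields.BalabanUV.T4Continuum.Spine.NE7b.SineTentSqLetter
import Summits.QuantumFields.BalabanUV.T4Continuum.Spine.NE7b.CurlTermsLinear
import Summits.QuantumFields.BalabanUV.T4Continuum.Spine.NE7b.PlaquetteTermDisplacement
import Summits.QuantumFields.BalabanUV.T4Continuum.Spine.NE7b.AveragedCurlFormSplit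

/-!
# THE ONE-FAMILY SINE-TENT FLOORS AND THE CURL-ONLY (h2) FLOOR BY THE SUMMED-SQUARE ROUTE: `…SineTentFloor` ∕ `…CurlOnlySineFloor` with the IMS error of
# `…AdmissibleFloorSqLetter` (`ε = ℓ²Λ²ab`) fed by `…SineTentSqLetter` (`Λ = D·π∕2L`, `Λ = π∕2L` in the plaquette shape) — for the curl form of the unit torus
# `((c_loc − (1+t⁻¹)·(π∕2L)²·4·2(d−1))∕(1+t))·Σ_c‖B c‖² ≤ Σ_P X_P(B)²` on `good`: d = 4 ⇒ `E·L² = 6π² ≈ 59.2`, informative from `L ≥ 11` (t = 1, c_loc = 1) — the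
# refuter's F762 ∕ Q-v128-1 number EXACTLY, against `96π² ≈ 947`, `L ≥ 44` on the `(hlip, hμ)` route (row NE7b, node U5c; residual (R2′) family (2), letter (ℓ1); junctions)

Cell `pub-balaban`, sub-cell `t4`, spine estimate NE7b (`T4WeightBudget.RelWeightBound`; the cell's OWN estimate — NOT PRINTED in [Bałaban 1983–89],
NOT PROVED).  Crux-route work under `Spine/NE7b/`; NOTHING of Bałaban's estimates is asserted; no `def`; zero `sorry`; no `T4Continuum/Support` leaf
(FREEZE (0)).  Imports BY NAME: this lineage's `…AdmissibleFloorSqLetter` (AFSQ: `ims_floor_of_linear_terms_sq`), `…SineTentSqLetter` (STSQ: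
`sum_sq_prod_sin_tent_sub_le_of_disp` ∕ `_of_unit`), `…CurlTermsLinear` (CTL), `…PlaquetteTermDisplacement` (PTD), `…AveragedCurlFormSplit` (ACFS), `…TorusPlaquetteIncidence`
(TPI) and STQ `sum_sq_prod_sin_tent_eq_one`.

WHAT IS PROVED ([folklore]; cutoffs `h_S(c) := Π_ν sin(π∕2·tentZ L ((pt c)_ν − (S_ν·L + c₀)))`, `N = M·L`, `0 < L`, `2 ≤ M`):
* §1 **`ims_floor_of_sine_tent_partition_sq`** — `…SineTentFloor.ims_floor_of_sine_tent_partition`'s twin: `((c_loc − (1+t⁻¹)·ℓ²·(Dπ∕(2L))²·ab)∕(1+t))·Σ_c‖x c‖² ≤ F x`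
  (no `(a+1)·2^{#A}`); **`ims_floor_of_sine_tent_partition_unit_sq`** — the plaquette shape: `((c_loc − (1+t⁻¹)·ℓ²·(π∕(2L))²·ab)∕(1+t))·Σ_c‖x c‖² ≤ F x` (no `2^{#A}`).
* §2 **`ims_floor_curl_only_sq`** — `…CurlOnlySineFloor.ims_floor_curl_only`'s twin, its binders VERBATIM:
  `((c_loc − (1+t⁻¹)·1²·(π∕(2L))²·4·2(d−1))∕(1+t))·Σ_c‖B c‖² ≤ Σ_P X_P(B)²` for `good B`.

NOT HERE (honest): the local floor `c_loc`, `good`, the transports `w`; anything of Bałaban's estimates.  COSF ∕ STF stay as landed (the `(hlip, hμ)` route).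
BY-NAME EFFECT ON THE WALL: NONE.  NE7b NOT PRINTED ∕ NOT PROVED; spine PROVED 0∕9; rung (B)+1 on ONE finite T⁴ — NOT infinite volume, NOT the mass gap, NOT Clay.
HONEST DEPENDENCY: continuum YM on T⁴ ⇐ BetaPertH ∧ nine spine estimates (0/9 proved); BetaPertH ⇐ (D1) ∧ (D4) ∧ CAP+tail; G-an2-4 gates asym, D1 and NE2/3/4.
-/

set_option autoImplicit false

noncomputable section

open Finset
open Literature.MathematicalPhysics.QuantumFieldTheory.Balaban1983to89.B14.TentUnityTorus (tentZ)
open Literature.MathematicalPhysics.QuantumFieldTheory.Balaban1983to89.B7Prop1Explicit (U1)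
open Literature.MathematicalPhysics.QuantumFieldTheory.Balaban1983to89.B7Eq78Linearization (conjR conjR_add conjR_smul_real)
open Summit.QuantumFields.BalabanUV.T4Continuum.NE7b.AdmissibleFloorSqLetter (ims_floor_of_linear_terms_sq)
open Summit.QuantumFields.BalabanUV.T4Continuum.NE7b.SineTentQuadraticPartition (sum_sq_prod_sin_tent_eq_one)
open Summit.QuantumFields.BalabanUV.T4Continuum.NE7b.SineTentSqLetter (sum_sq_prod_sin_tent_sub_le_of_disp sum_sq_prod_sin_tent_sub_le_of_unit)
open Summit.QuantumFields.BalabanUV.T4Continuum.NE7b.CurlTermsLinear (norm_curlMap_le sum_sq_norm_curlMaps_eq)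
open Summit.QuantumFields.BalabanUV.T4Continuum.NE7b.PlaquetteTermDisplacement (exists_unit_plaquetteBonds)
open Summit.QuantumFields.BalabanUV.T4Continuum.NE7b.AveragedCurlFormSplit (card_image_four_le)
open Summit.QuantumFields.BalabanUV.T4Continuum.NE7b.TorusPlaquetteIncidence (card_plaquettes_through_bond_le)

namespace Summit.QuantumFields.BalabanUV.T4Continuum.NE7b.CurlOnlySineFloorSq

/-! ## §1 One family on the torus with the sine-tent partition, summed-square route -/

section OneFamily

variable {A : Type*} [Fintype A] [DecidableEq A]
variable {J C : Type*} [Fintype J] [Fintype C]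
variable {W V : Type*} [NormedAddCommGroup W] [NormedSpace ℝ W] [NormedAddCommGroup V] [NormedSpace ℝ V]

/-- **THE (h2) FLOOR WITH THE SINE-TENT PARTITION, SUMMED-SQUARE ROUTE** — AFSQ `ims_floor_of_linear_terms_sq` with `hpart` exact and `Λ = D·π∕(2L)` from STSQ:
`((c_loc − (1+t⁻¹)·ℓ²·(Dπ∕(2L))²·ab)∕(1+t))·Σ_c‖x c‖² ≤ F x` on `good`. [folklore] -/
theorem ims_floor_of_sine_tent_partition_sq [DecidableEq C] (L M N : ℕ) [NeZero M] [NeZero N] (hL : 0 < L) (hM : 2 ≤ M) (hN : N = M * L) (c₀ : ℕ)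
    (inc : J → Finset C) (R : J → C → W →ₗ[ℝ] V) {ℓ : ℝ} (hR : ∀ j c v, ‖R j c v‖ ≤ ℓ * ‖v‖)
    (pt : C → A → ZMod N) (ref : J → C) (D : ℕ)
    (hdisp : ∀ j, ∀ b ∈ inc j, ∃ wp wm : A → ℕ,
      pt b = pt (ref j) + (fun ν => ((wp ν : ℕ) : ZMod N)) - (fun ν => ((wm ν : ℕ) : ZMod N)) ∧ ∑ ν, wp ν + ∑ ν, wm ν ≤ D)
    {a b : ℕ} (ha : ∀ j, (inc j).card ≤ a) (hb : ∀ c, (Finset.univ.filter fun j => c ∈ inc j).card ≤ b)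
    (good : (C → W) → Prop) {cloc : ℝ}
    (hloc : ∀ (S : A → ZMod M) (x : C → W), good x →
      cloc * ∑ c, ‖(∏ ν, Real.sin (Real.pi / 2 * tentZ (L : ℝ) (pt c ν - (((S ν).val * L + c₀ : ℕ) : ZMod N)))) • x c‖ ^ 2
        ≤ ∑ j, ‖∑ c ∈ inc j, R j c ((∏ ν, Real.sin (Real.pi / 2 * tentZ (L : ℝ) (pt c ν - (((S ν).val * L + c₀ : ℕ) : ZMod N)))) • x c)‖ ^ 2)
    (F : (C → W) → ℝ) (hF : ∀ x, good x → ∑ j, ‖∑ c ∈ inc j, R j c (x c)‖ ^ 2 ≤ F x)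
    {t : ℝ} (ht : 0 < t) (x : C → W) (hx : good x) :
    (cloc - (1 + t⁻¹) * (ℓ ^ 2 * (D * (Real.pi / (2 * L))) ^ 2 * a * b)) / (1 + t) * ∑ c, ‖x c‖ ^ 2 ≤ F x :=
  ims_floor_of_linear_terms_sq (ι := A → ZMod M) inc R hR
    (fun (S : A → ZMod M) (c : C) => ∏ ν, Real.sin (Real.pi / 2 * tentZ (L : ℝ) (pt c ν - (((S ν).val * L + c₀ : ℕ) : ZMod N))))
    (fun c => sum_sq_prod_sin_tent_eq_one L M N hL hM hN c₀ (pt c)) ref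
    (Λ := D * (Real.pi / (2 * L))) (sum_sq_prod_sin_tent_sub_le_of_disp L M N hL hM hN c₀ pt inc ref D hdisp)
    ha hb good hloc F hF ht x hx

/-- **… IN THE PLAQUETTE SHAPE** (`hunit`): `((c_loc − (1+t⁻¹)·ℓ²·(π∕(2L))²·ab)∕(1+t))·Σ_c‖x c‖² ≤ F x`. [folklore] -/
theorem ims_floor_of_sine_tent_partition_unit_sq [DecidableEq C] (L M N : ℕ) [NeZero M] [NeZero N] (hL : 0 < L) (hM : 2 ≤ M) (hN : N = M * L)
    (c₀ : ℕ)
    (inc : J → Finset C) (R : J → C → W →ₗ[ℝ] V) {ℓ : ℝ} (hR : ∀ j c v, ‖R j c v‖ ≤ ℓ * ‖v‖)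
    (pt : C → A → ZMod N) (ref : J → C)
    (hunit : ∀ j, ∀ b ∈ inc j, pt b = pt (ref j) ∨ ∃ ν, pt b = Function.update (pt (ref j)) ν (pt (ref j) ν + 1))
    {a b : ℕ} (ha : ∀ j, (inc j).card ≤ a) (hb : ∀ c, (Finset.univ.filter fun j => c ∈ inc j).card ≤ b)
    (good : (C → W) → Prop) {cloc : ℝ}
    (hloc : ∀ (S : A → ZMod M) (x : C → W), good x →
      cloc * ∑ c, ‖(∏ ν, Real.sin (Real.pi / 2 * tentZ (L : ℝ) (pt c ν - (((S ν).val * L + c₀ : ℕ) : ZMod N)))) • x c‖ ^ 2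
        ≤ ∑ j, ‖∑ c ∈ inc j, R j c ((∏ ν, Real.sin (Real.pi / 2 * tentZ (L : ℝ) (pt c ν - (((S ν).val * L + c₀ : ℕ) : ZMod N)))) • x c)‖ ^ 2)
    (F : (C → W) → ℝ) (hF : ∀ x, good x → ∑ j, ‖∑ c ∈ inc j, R j c (x c)‖ ^ 2 ≤ F x)
    {t : ℝ} (ht : 0 < t) (x : C → W) (hx : good x) :
    (cloc - (1 + t⁻¹) * (ℓ ^ 2 * (Real.pi / (2 * L)) ^ 2 * a * b)) / (1 + t) * ∑ c, ‖x c‖ ^ 2 ≤ F x :=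
  ims_floor_of_linear_terms_sq (ι := A → ZMod M) inc R hR
    (fun (S : A → ZMod M) (c : C) => ∏ ν, Real.sin (Real.pi / 2 * tentZ (L : ℝ) (pt c ν - (((S ν).val * L + c₀ : ℕ) : ZMod N))))
    (fun c => sum_sq_prod_sin_tent_eq_one L M N hL hM hN c₀ (pt c)) ref
    (Λ := Real.pi / (2 * L)) (sum_sq_prod_sin_tent_sub_le_of_unit L M N hL hM hN c₀ pt inc ref hunit)
    ha hb good hloc F hF ht x hx

end OneFamily

/-! ## §2 The curl-only floor of the unit torus — `…CurlOnlySineFloor.ims_floor_curl_only`'s twin -/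

variable {d : ℕ}
variable {𝔸 : Type*} [NormedRing 𝔸] [NormedAlgebra ℂ 𝔸] [NormOneClass 𝔸]

/-- **THE CURL-ONLY (h2) FLOOR AT k = 1, SUMMED-SQUARE ROUTE** (COSF's binders VERBATIM; `E = 1²·(π∕(2L))²·4·2(d−1)`, no `2^d`; d = 4: `E·L² = 6π²`). [folklore] -/
theorem ims_floor_curl_only_sq (L M N : ℕ) [NeZero M] [NeZero N] [Fact (1 < N)] (hL : 0 < L) (hM : 2 ≤ M) (hN : N = M * L) (c₀ : ℕ)
    (ι : (Fin d → ZMod N) × {a : Fin d × Fin d // a.1 < a.2} → Fin 4 → (Fin d → ZMod N) × Fin d)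
    (hι : ∀ x a, ι (x, a) = ![(x, a.1.1), (x + Pi.single a.1.1 1, a.1.2), (x + Pi.single a.1.2 1, a.1.1), (x, a.1.2)])
    (w : (Fin d → ZMod N) × {a : Fin d × Fin d // a.1 < a.2} → Fin 3 → 𝔸ˣ) (hw : ∀ P i, w P i ∈ U1 𝔸)
    (R : (Fin d → ZMod N) × {a : Fin d × Fin d // a.1 < a.2} → (Fin d → ZMod N) × Fin d → 𝔸 →ₗ[ℝ] 𝔸)
    (hR : ∀ P c, R P c =
        if c = ι P 0 then LinearMap.id
        else if c = ι P 1 then LinearMap.mk ⟨conjR (w P 0), conjR_add (w P 0)⟩ (conjR_smul_real (w P 0))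
        else if c = ι P 2 then -LinearMap.mk ⟨conjR (w P 1), conjR_add (w P 1)⟩ (conjR_smul_real (w P 1))
        else if c = ι P 3 then -LinearMap.mk ⟨conjR (w P 2), conjR_add (w P 2)⟩ (conjR_smul_real (w P 2))
        else 0)
    (X : (Fin d → ZMod N) × {a : Fin d × Fin d // a.1 < a.2} → ((Fin d → ZMod N) → Fin d → 𝔸) → ℝ)
    (hX : ∀ (y : Fin d → ZMod N) (a : {a : Fin d × Fin d // a.1 < a.2}) (B : (Fin d → ZMod N) → Fin d → 𝔸), X (y, a) B =
      ‖B y a.1.1 + conjR (w (y, a) 0) (B (y + Pi.single a.1.1 1) a.1.2) - conjR (w (y, a) 1) (B (y + Pi.single a.1.2 1) a.1.1)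
        - conjR (w (y, a) 2) (B y a.1.2)‖)
    (good : ((Fin d → ZMod N) × Fin d → 𝔸) → Prop) {cloc : ℝ}
    (hloc : ∀ (S : Fin d → ZMod M) (x : (Fin d → ZMod N) × Fin d → 𝔸), good x →
      cloc * ∑ c, ‖(∏ ν, Real.sin (Real.pi / 2 * tentZ (L : ℝ) (c.1 ν - (((S ν).val * L + c₀ : ℕ) : ZMod N)))) • x c‖ ^ 2
        ≤ ∑ P, ‖∑ c ∈ Finset.univ.image (ι P),
            R P c ((∏ ν, Real.sin (Real.pi / 2 * tentZ (L : ℝ) (c.1 ν - (((S ν).val * L + c₀ : ℕ) : ZMod N)))) • x c)‖ ^ 2)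
    {t : ℝ} (ht : 0 < t) (x : (Fin d → ZMod N) × Fin d → 𝔸) (hx : good x) :
    (cloc - (1 + t⁻¹) * ((1 : ℝ) ^ 2 * (Real.pi / (2 * L)) ^ 2 * (4 : ℕ) * (2 * (d - 1) : ℕ))) / (1 + t)
        * ∑ c, ‖x c‖ ^ 2 ≤ ∑ P, X P (fun y μ => x (y, μ)) ^ 2 := by
  classical
  have hF : ∀ z : (Fin d → ZMod N) × Fin d → 𝔸, good z →
      ∑ P, ‖∑ c ∈ Finset.univ.image (ι P), R P c (z c)‖ ^ 2 ≤ ∑ P, X P (fun y μ => z (y, μ)) ^ 2 :=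
    fun z _ => le_of_eq (sum_sq_norm_curlMaps_eq ι hι w R hR X hX (fun y μ => z (y, μ)))
  exact ims_floor_of_sine_tent_partition_unit_sq (A := Fin d) L M N hL hM hN c₀
    (fun P => Finset.univ.image (ι P)) R (ℓ := 1) (fun P c v => norm_curlMap_le ι w hw R hR P c v)
    Prod.fst (fun P => ι P 0) (exists_unit_plaquetteBonds ι hι)
    (a := 4) (b := 2 * (d - 1)) (fun P => card_image_four_le (ι P)) (fun c => card_plaquettes_through_bond_le ι hι c)
    good hloc (fun z => ∑ P, X P (fun y μ => z (y, μ)) ^ 2) hF ht x hx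

end Summit.QuantumFields.BalabanUV.T4Continuum.NE7b.CurlOnlySineFloorSq

end
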